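import Literature.AnabelianGeometry.AbsoluteAnabelian.AbsTopII.BelyiCuspidalizationContent
import Literature.AnabelianGeometry.AbsoluteAnabelian.AbsTopII.CuspidalizationComparisonSchemaScope
import HarnessLib

/-!
# [AbsTopII] Cor 3.7 with the content of (a) (`BelyiModel.Cor_3_7'`): the NON-VACUOUS instance form —
# point-preserving NF-opens realize the identity chain with an empty •-tail

S. Mochizuki, *Topics in Absolute Anabelian Geometry II: Decomposition Groups and Endomorphisms*
[AbsTopII] (bib key `MochizukiAbsTopII2013`; manuscript pagination, lit key `paper:url-585b8d0ad0d9`):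
Example 3.6 pp. 71–72, Corollary 3.7 pp. 72–73; [AbsTopI] (`MochizukiAbsTopI2012`) Def 4.2 (iii)
pp. 49–50.

PROOF-ONLY companion (no definition, no instance, no structure) of abc-iut-L4-t6's
`AbsTopII/BelyiCuspidalizationContent.lean` (p432148: `BelyiCuspidalization.RealizesChain`,
`BelyiModel.Cor_3_7'` — the repair of finding F-f064-1, abc-iut-L4-lead RULING #5w (1)), cell
abc-iut, seat abc-iut-f-064 (author of F-f064-1).  Sibling of
`AbsTopII/BelyiCuspidalizationContentSchemaScope.lean` (same seat: with NO cusp recorded on `X` the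
repaired predicate forces every NF-open to be point-preserving, and a junk model separates `Cor_3_7'`
from the frozen `Cor_3_7`).  This file supplies the converse half, the instance form of the repaired
predicate that DOES hold non-vacuously:

* `BelyiModel.realizesChain_of_cuspOf_injective` — for a member `X` satisfying the standing
  hypotheses of Cor 3.7 and an NF-open `U_X` that removes NO point (`Π_{U_X} ↠ Π` injective, i.e. a
  continuous bijection of profinite groups), the output "`Π_V := Π`, `Π_U := Π_{U_X}`, chain
  parameters `(l, n, m) = (0, 0, 0)`" REALIZES the identity chain `Π ⇝ Π ⇝ Π ⇝ Π ⇝ Π` of type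
  `⋏, ⋎, ⋏, ⋎` (Ex 3.6 (ii) with `l = n = m = 0`): the •-tail at the second-to-last term is EMPTY and
  the tracked composite is the isomorphism `Π_U ⥲ Π = Π_V`, i.e. `Π_U ↠ Π_V` itself;
* `BelyiModel.cor_3_7'_of_cuspOf_injective` — hence a model all of whose NF-opens (on members
  satisfying the hypotheses) are point-preserving satisfies `Cor_3_7'`.

With the sibling's `BelyiModel.Cor_3_7'.cuspOf_injective_of_isEmpty_cusp` this is TIGHT: at a member
with no recorded cusp, `Cor_3_7'` holds for EXACTLY the point-preserving NF-opens — the content of the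
repaired (a) ("the natural surjection `Π_U ↠ Π_V` may be recovered from the chain of •’s", p. 73) is
carried entirely by the steps of type • at recorded cusps of `X` ([AbsTopI] Def 4.2 (iii) (3_Π), (c)).

READING (honest framing): statements about OUR typed interface `(𝒟, M)`; a point-preserving "NF-open"
is the degenerate datum `U_X = X`, for which print's (a) is the empty construction.  Nothing in print
is touched; typed ≠ proved; no side taken on [IUTchIII] Cor 3.12.
-/

open CategoryTheory Topology
open scoped Pointwise

universe u

namespace Literature.AnabelianGeometry.AbsoluteAnabelian.AbsTopII

open Literature.AlgebraicGeometry.Frobenioids (IsSlimGroup)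
open FundamentalExtension
open AbsTopI (ConstructionDataClass)

variable {𝒟 : ConstructionDataClass.{u}}

namespace BelyiModel

variable (M : BelyiModel 𝒟)

/-- **A point-preserving NF-open realizes the identity chain.**  For a member `X` satisfying the
standing hypotheses of Cor 3.7 and an NF-open `U_X` with `Π_{U_X} ↠ Π` INJECTIVE (so an isomorphism
of profinite groups `Π_{U_X} ⥲ Π`), there is an output of the Cor-3.7 shape with `Π_V := Π`,
`Π_U := Π_{U_X}`, chain parameters `(0, 0, 0)`, whose cuspidalization IS the model's `Π_{U_X} ↠ Π`
(same images of cuspidal decomposition groups) and which REALIZES ("(a) … such that … the natural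
surjection `Π_U ↠ Π_V` may be recovered from the chain of •’s terminating at the second to last
group", p. 73) the identity chain `Π ⇝ Π ⇝ Π ⇝ Π ⇝ Π` of type `⋏, ⋎, ⋏, ⋎`: indices `s = t = 3`,
EMPTY •-tail, `Π_U ⥲ Π₃ = Π` the isomorphism `Π_{U_X} ⥲ Π`, `Π_V = Π ⥲ Π₃` the identity.  Centre-
freeness of `Π_U ≅ Π` (clause (b)) comes from the slimness of `Π` ([AbsAnab] Lem 1.3.1,
`IsCor37Member.arith_slim`). [cite: MochizukiAbsTopII2013, Cor 3.7 pp.72-73] -/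
theorem realizesChain_of_cuspOf_injective {b : 𝒟.Base} {X : (𝒟.datum b).Obj}
    (h : M.IsCor37Member b X) (U : M.NFOpen b X)
    (hinj : Function.Injective (M.cuspOf U).hom.arith) :
    ∃ B : BelyiCuspidalization ((𝒟.datum b).ext X),
      B.cusp = M.cuspOf U ∧ B.PiV = ⊤ ∧ B.chainParams = (0, 0, 0) ∧
        B.cusp.decompositionImages B.cusps = (M.cuspOf U).decompositionImages (M.cuspsOf U) ∧
        B.RealizesChain (M.cusps b X) h.arith_slim h.geom_slim h.geom_ne_bot := by
  have hP := h.arith_slim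
  have hΔ := h.geom_slim
  have hne := h.geom_ne_bot
  -- `Π_{U_X} ↠ Π` is a continuous bijection of profinite groups, i.e. an isomorphism `eU`
  have hb : Function.Bijective (M.cuspOf U).hom.arith := ⟨hinj, (M.cuspOf U).arith_surjective⟩
  let hh : (M.cuspOf U).ext.arith ≃ₜ ((𝒟.datum b).ext X).arith :=
    Continuous.homeoOfEquivCompactToT2 (f := Equiv.ofBijective _ hb) (M.cuspOf U).hom.arith.continuous
  let eU : (M.cuspOf U).ext.arith ≃ₜ* ((𝒟.datum b).ext X).arith :=
    { MulEquiv.ofBijective (M.cuspOf U).hom.arith hb with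
      continuous_toFun := (M.cuspOf U).hom.arith.continuous
      continuous_invFun := hh.symm.continuous }
  -- so `Π_{U_X} ≅ Π` is slim ([AbsAnab] Lem 1.3.1), hence `Π_U = Π_{U_X}` is centre-free
  have hslim : IsSlimGroup (M.cuspOf U).ext.arith := isSlimGroup_of_continuousMulEquiv eU.symm hP
  have hcen : Subgroup.center
      ↥((⊤ : Subgroup ((𝒟.datum b).ext X).arith).comap (M.cuspOf U).hom.arith.toMonoidHom) = ⊥ := by
    rw [eq_bot_iff]
    intro z hz
    rw [Subgroup.mem_bot]
    apply Subtype.ext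
    have h1 : (z : (M.cuspOf U).ext.arith) ∈
        Subgroup.centralizer ((⊤ : Subgroup (M.cuspOf U).ext.arith) : Set (M.cuspOf U).ext.arith) := by
      rw [Subgroup.mem_centralizer_iff]
      intro g _
      have hg : g ∈ (⊤ : Subgroup ((𝒟.datum b).ext X).arith).comap
          (M.cuspOf U).hom.arith.toMonoidHom := by
        rw [Subgroup.mem_comap]
        exact Subgroup.mem_top _
      exact congrArg Subtype.val (Subgroup.mem_center_iff.1 hz ⟨g, hg⟩)
    rw [hslim.centralizer_eq_bot ⊤ isOpen_univ, Subgroup.mem_bot] at h1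
    exact h1
  -- the output: `Π_V := Π`, `Π_U := Π_{U_X}`, chain parameters `(0, 0, 0)`
  let B : BelyiCuspidalization ((𝒟.datum b).ext X) :=
    { PiV := ⊤
      normal_PiV := inferInstance
      isOpen_PiV := by
        rw [Subgroup.coe_top]
        exact isOpen_univ
      chainParams := (0, 0, 0)
      cuspU := (M.cuspOf U).ext
      projU := (M.cuspOf U).hom
      range_projU_arith := MonoidHom.range_eq_top.2 (M.cuspOf U).arith_surjective
      range_projU_gal := by
        rw [MonoidHom.range_eq_top.2 (M.cuspOf U).gal_bijective.2, ← MonoidHom.range_eq_map,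
          MonoidHom.range_eq_top.2 ((𝒟.datum b).ext X).aug_surjective]
      cusp := M.cuspOf U
      glue := (MulEquiv.subgroupCongr (Subgroup.comap_top _)).trans Subgroup.topEquiv
      glue_comm := fun _ => rfl
      lifting_unique := fun ρ ρ' hρ hρ' _ _ => by
        refine MonoidHom.ext fun g => ?_
        rw [(MonoidHom.mem_ker).1 (hρ (Subgroup.mem_top g)),
          (MonoidHom.mem_ker).1 (hρ' (Subgroup.mem_top g))]
      center_PiU_eq_bot := hcen
      cusps := M.cuspsOf U }
  -- the identity chain `Π ⇝ Π ⇝ Π ⇝ Π ⇝ Π` of type `⋏, ⋎, ⋏, ⋎`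
  let ch : ((𝒟.datum b).ext X).PiChain (M.cusps b X) hP hΔ hne :=
    { len := 4
      term := fun _ => ChainGroup.self hP hΔ hne
      term_zero := rfl
      types := ![.finEtCov, .finEtQuot, .finEtCov, .finEtQuot]
      isElemOp := fun j => by
        fin_cases j
        · exact isElemOp_finEtCov_self
        · exact isElemOp_finEtQuot_self
        · exact isElemOp_finEtCov_self
        · exact isElemOp_finEtQuot_self }
  refine ⟨B, rfl, rfl, rfl, rfl, ch, rfl, ⟨ContinuousMulEquiv.refl _, 1, fun x => ?_⟩,
    3, 3, rfl, rfl, eU, topContinuousMulEquiv _, 1, 1, fun _ => eU.toMonoidHom, fun x => ?_,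
    fun y => ?_, fun _ => rfl, fun j h₁ h₂ => absurd (lt_of_le_of_lt h₁ h₂) (lt_irrefl _),
    fun _ => rfl⟩
  · simp only [map_one, MulAut.one_apply]
    rfl
  · simp only [map_one, MulAut.one_apply]
    exact (M.cuspOf U).hom.comm x
  · simp only [map_one, MulAut.one_apply]
    rfl

/-- **NON-VACUOUS instance form of the repaired Cor 3.7**: a model all of whose NF-opens (on members
satisfying the standing hypotheses) remove NO point — every `Π_{U_X} ↠ Π` injective, "`U_X = X`" —
satisfies `BelyiModel.Cor_3_7'`, by `realizesChain_of_cuspOf_injective` (the hypotheses "`𝒟`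
chain-full, rel-isom-DGC" are not used).  TIGHT against the sibling certificate
`Cor_3_7'.cuspOf_injective_of_isEmpty_cusp` (`BelyiCuspidalizationContentSchemaScope.lean`): at a member
with no recorded cusp these are the ONLY NF-opens for which `Cor_3_7'` can hold.
[cite: MochizukiAbsTopII2013, Cor 3.7 pp.72-73] -/
theorem cor_3_7'_of_cuspOf_injective
    (hinj : ∀ (b : 𝒟.Base) (X : (𝒟.datum b).Obj), M.IsCor37Member b X → ∀ U : M.NFOpen b X,
      Function.Injective (M.cuspOf U).hom.arith) : M.Cor_3_7' := by
  intro _ _ b X h U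
  obtain ⟨B, hB, -, -, himg, hreal⟩ := M.realizesChain_of_cuspOf_injective h U (hinj b X h U)
  refine ⟨B, ?_, himg, hreal⟩
  rw [hB]
  exact Cuspidalization.IsoOver.refl _

end BelyiModel

end Literature.AnabelianGeometry.AbsoluteAnabelian.AbsTopII
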